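import Summits.KontsevichZagierPeriods.KontsevichZagierPeriods.Theorems.HurwitzMicroSectorsNormalFormPrincipleDimOneAssembly

/-!
# `NormalFormPrinciple` (stmt-KontsevichZagierPeriods-3869), line `SketchIdeator1` —
# the leaf off the box in dimension one, VI: algebraic coefficients on bounded slabs

Pure proof file (lead seat c4; `--supports` the crux). The kernel theorem of file IV
(`mem_relations_of_eval_eq_zero_of_dim_le_one`) is extended from the subgroup generated by the
representations of KZ's rational shape (`ℚ`-coefficients) of dimension `≤ 1` to the subgroup
generated ALSO by (i) the slab representations `[(a,b), P/Q]` with real ALGEBRAIC ends `a, b` and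
`P, Q ∈ K[X]` (`K = ℚ̄ ∩ ℝ`), `Q` pole-free on `[a,b]` — the shape of every intermediate representation
of the line's engine (carriers `Λ(a,b,c) = [(a,b), c/x]`, arctangent carriers `[(0,t), d/(1+x²)]`,
partial fractions over `K`) — and (ii) the point representations `[pt, r]` with `r` real algebraic
(`mem_relations_of_eval_eq_zero_of_algSlab`). In particular every `ℤ`-linear relation among the
values `c·log(b/a)`, `d·arctan t`, `r` of such representations that holds in `ℝ` is realised by the
four moves (`nfD_of_algSlab`: one affine move with algebraic coefficients, then `nfD_of_algK`).

Sources: M. Kontsevich, D. Zagier, *Periods* (2001), §1.1 (algebraic coefficients), §1.2 Conjecture 1;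
A. Baker, *Transcendental Number Theory* (1975), Thm. 2.1. No definitions are introduced.
-/

noncomputable section

open MeasureTheory Set Finset
open scoped Polynomial
open Literature.NumberTheory.Transcendental Literature.NumberTheory.Transcendental.KZ
open Literature.ModelTheory.ExponentialFields (IsSemialgebraic isSemialgebraic_univ)

namespace Summit.KontsevichZagierPeriods.HurwitzMicroSectors.NormalFormPrinciple.PiBox

namespace Dlog

variable {RA : ℝ → ℝ → ℝ → IntegralRep 1} {ZA : ℝ → IntegralRep 0} {RG : ℝ → ℝ → IntegralRep 1}

/-! ## Slabs with algebraic ends and `K`-rational integrands are mixed normal forms -/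

/-- **A `K`-rational representation on a bounded slab with algebraic ends is a mixed normal form.**
If `N = [(a,b), P/Q]` with `a, b` real algebraic, `P, Q ∈ K[X]` (`K = ℚ̄ ∩ ℝ`) and `Q` without zeros
on `[a,b]`, then the class of `N` is a mixed normal form: for `a < b` one affine move
`x = a + (b−a)t` with algebraic coefficients (`AlgSplitK5.affineA_sub_mem_relations`) to the unit
slab, where the pulled-back integrand `(b−a)P(a+(b−a)t)/Q(a+(b−a)t)` is again `K`-rational and
pole-free on `[0,1]` (`nfD_of_algK`); for `b ≤ a` the slab is empty.
[cite: KontsevichZagier2001, §1.2 rule (2)] -/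
theorem nfD_of_algSlab
    (hR : ∀ a b c, IsAlgebraic ℚ a → IsAlgebraic ℚ b → IsAlgebraic ℚ c → 0 < a →
      (RA a b c).domain = {x | x 0 ∈ Set.Ioo a b} ∧ (RA a b c).integrand = fun x => c / x 0)
    (hZ : ∀ r, IsAlgebraic ℚ r → (ZA r).domain = univ ∧ (ZA r).integrand = fun _ => r)
    (hRG : ∀ t d, IsAlgebraic ℚ t → IsAlgebraic ℚ d →
      (RG t d).domain = {x | x 0 ∈ Set.Ioo 0 t} ∧ (RG t d).integrand = fun x => d / (1 + x 0 ^ 2))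
    {a b : ℝ} (ha : IsAlgebraic ℚ a) (hb : IsAlgebraic ℚ b) (P Q : (algebraicClosure ℚ ℝ)[X])
    (hQ : ∀ t ∈ Set.Icc a b, (Polynomial.aeval t Q : ℝ) ≠ 0)
    (N : IntegralRep 1) (hNd : N.domain = {x | x 0 ∈ Set.Ioo a b})
    (hNi : EqOn N.integrand (fun x => (Polynomial.aeval (x 0) P : ℝ) / Polynomial.aeval (x 0) Q)
      N.domain) :
    ∃ (r : ℝ) (k : ℕ) (u c : Fin k → ℝ) (k' : ℕ) (t d : Fin k' → ℝ), IsAlgebraic ℚ r ∧ (∀ j, 1 < u j) ∧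
      (∀ j, IsAlgebraic ℚ (u j)) ∧ (∀ j, IsAlgebraic ℚ (c j)) ∧ (∀ l, 0 ≤ t l) ∧
      (∀ l, IsAlgebraic ℚ (t l)) ∧ (∀ l, IsAlgebraic ℚ (d l)) ∧
      QuotientAddGroup.mk' relations (of N) = QuotientAddGroup.mk' relations (of (ZA r)) +
        ∑ j, QuotientAddGroup.mk' relations (of (RA 1 (u j) (c j))) +
        ∑ l, QuotientAddGroup.mk' relations (of (RG (t l) (d l))) := by
  by_cases hab : a < b
  swap
  · have h0 : QuotientAddGroup.mk' relations (of N) = 0 :=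
      (QuotientAddGroup.eq_zero_iff _).mpr (slab_empty_mem_relations N hNd (not_lt.mp hab))
    rw [h0]
    exact nfD_zero hZ
  have hs : 0 < b - a := sub_pos.mpr hab
  have hsA : IsAlgebraic ℚ (b - a) := hb.sub ha
  set a' : algebraicClosure ℚ ℝ := ⟨a, mem_algebraicClosure_iff.mpr ha⟩ with ha'
  set s' : algebraicClosure ℚ ℝ := ⟨b - a, mem_algebraicClosure_iff.mpr hsA⟩ with hs'
  set Φp : (algebraicClosure ℚ ℝ)[X] := Polynomial.C a' + Polynomial.C s' * Polynomial.X with hΦp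
  set Pt : (algebraicClosure ℚ ℝ)[X] := Polynomial.C s' * P.comp Φp with hPt
  set Qt : (algebraicClosure ℚ ℝ)[X] := Q.comp Φp with hQt
  have hΦev : ∀ t : ℝ, (Polynomial.aeval t Φp : ℝ) = a + (b - a) * t := by
    intro t
    rw [hΦp, map_add, map_mul, Polynomial.aeval_C, Polynomial.aeval_C, Polynomial.aeval_X]
    rfl
  have hQtev : ∀ t : ℝ, (Polynomial.aeval t Qt : ℝ) = Polynomial.aeval (a + (b - a) * t) Q := by
    intro t
    rw [hQt, Polynomial.aeval_comp, hΦev]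
  have hPtev : ∀ t : ℝ, (Polynomial.aeval t Pt : ℝ) = (b - a) * Polynomial.aeval (a + (b - a) * t) P := by
    intro t
    rw [hPt, map_mul, Polynomial.aeval_C, Polynomial.aeval_comp, hΦev]
    rfl
  have hmem : ∀ t ∈ Set.Icc (0:ℝ) 1, a + (b - a) * t ∈ Set.Icc a b := by
    intro t ht
    constructor <;> nlinarith [ht.1, ht.2, hs]
  have hQt01 : ∀ t ∈ Set.Icc (0:ℝ) 1, (Polynomial.aeval t Qt : ℝ) ≠ 0 := by
    intro t ht
    rw [hQtev]
    exact hQ _ (hmem t ht)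
  obtain ⟨T, hTd, hTi⟩ := AlgSplitK5.exists_repK_unit Pt Qt hQt01
  have hmove : of T - of N ∈ relations := by
    refine AlgSplitK5.affineA_sub_mem_relations (s := b - a) (t := a) hsA ha hs.ne' T N
      (fun y => (Polynomial.aeval y P : ℝ) / Polynomial.aeval y Q) ?_ hNi fun x _ => ?_
    · rw [hTd, image_affine_slab_of_pos hs, hNd, mul_zero, zero_add, mul_one, sub_add_cancel]
    · rw [hTi, abs_of_pos hs]
      simp only
      rw [hPtev, hQtev, show a + (b - a) * x 0 = (b - a) * x 0 + a from add_comm _ _]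
      ring
  have hcls : QuotientAddGroup.mk' relations (of N) = QuotientAddGroup.mk' relations (of T) := by
    rw [← QuotientAddGroup.eq_zero_iff] at hmove
    change QuotientAddGroup.mk' relations _ = 0 at hmove
    rw [map_sub, sub_eq_zero] at hmove
    exact hmove.symm
  rw [hcls]
  exact nfD_of_algK hR hZ hRG Pt Qt hQt01 T hTd (by rw [hTi]; exact fun _ _ => rfl)

/-! ## The kernel theorem on the larger subgroup -/

/-- **Classes in the subgroup generated by rational representations of dimension `≤ 1`, `K`-rational
slab representations with algebraic ends, and algebraic points are mixed normal forms.**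
[cite: KontsevichZagier2001, §1.2] -/
theorem nfD_of_mem_closure_algSlab
    (hR : ∀ a b c, IsAlgebraic ℚ a → IsAlgebraic ℚ b → IsAlgebraic ℚ c → 0 < a →
      (RA a b c).domain = {x | x 0 ∈ Set.Ioo a b} ∧ (RA a b c).integrand = fun x => c / x 0)
    (hZ : ∀ r, IsAlgebraic ℚ r → (ZA r).domain = univ ∧ (ZA r).integrand = fun _ => r)
    (hRG : ∀ t d, IsAlgebraic ℚ t → IsAlgebraic ℚ d →
      (RG t d).domain = {x | x 0 ∈ Set.Ioo 0 t} ∧ (RG t d).integrand = fun x => d / (1 + x 0 ^ 2))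
    {x : FormalRep}
    (hx : x ∈ AddSubgroup.closure
      ({y : FormalRep | ∃ (m : ℕ) (N : IntegralRep m), m ≤ 1 ∧ N.IsRational ∧ y = of N} ∪
       {y : FormalRep | ∃ (a b : ℝ) (P Q : (algebraicClosure ℚ ℝ)[X]) (N : IntegralRep 1),
          IsAlgebraic ℚ a ∧ IsAlgebraic ℚ b ∧ (∀ t ∈ Set.Icc a b, (Polynomial.aeval t Q : ℝ) ≠ 0) ∧
          N.domain = {x | x 0 ∈ Set.Ioo a b} ∧
          EqOn N.integrand (fun x => (Polynomial.aeval (x 0) P : ℝ) / Polynomial.aeval (x 0) Q) N.domain ∧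
          y = of N} ∪
       {y : FormalRep | ∃ (r : ℝ) (Z : IntegralRep 0), IsAlgebraic ℚ r ∧ Z.domain = univ ∧
          (Z.integrand = fun _ => r) ∧ y = of Z})) :
    ∃ (r : ℝ) (k : ℕ) (u c : Fin k → ℝ) (k' : ℕ) (t d : Fin k' → ℝ), IsAlgebraic ℚ r ∧ (∀ j, 1 < u j) ∧
      (∀ j, IsAlgebraic ℚ (u j)) ∧ (∀ j, IsAlgebraic ℚ (c j)) ∧ (∀ l, 0 ≤ t l) ∧
      (∀ l, IsAlgebraic ℚ (t l)) ∧ (∀ l, IsAlgebraic ℚ (d l)) ∧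
      QuotientAddGroup.mk' relations x = QuotientAddGroup.mk' relations (of (ZA r)) +
        ∑ j, QuotientAddGroup.mk' relations (of (RA 1 (u j) (c j))) +
        ∑ l, QuotientAddGroup.mk' relations (of (RG (t l) (d l))) := by
  induction hx using AddSubgroup.closure_induction with
  | mem y hy =>
    rcases hy with (hy | hy) | hy
    · obtain ⟨m, N, hm, hN, rfl⟩ := hy
      exact nfD_of_isRational_dim_le_one hR hZ hRG hm N hN
    · obtain ⟨a, b, P, Q, N, ha, hb, hQ, hNd, hNi, rfl⟩ := hy
      exact nfD_of_algSlab hR hZ hRG ha hb P Q hQ N hNd hNi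
    · obtain ⟨r, Z, hr, hZd, hZi, rfl⟩ := hy
      exact nfD_pt hZ hr Z hZd hZi
  | zero => rw [map_zero]; exact nfD_zero hZ
  | add y z _ _ ihy ihz => rw [map_add]; exact nfD_add hZ ihy ihz
  | neg y _ ih => rw [map_neg]; exact nfD_neg hR hZ hRG ih

/-- **Conjecture 1 in dimension `≤ 1` with algebraic coefficients, kernel form.** A formal
`ℤ`-combination of (a) representations of KZ's rational shape of dimensions `≤ 1`, (b) slab
representations `[(a,b), P/Q]` with real algebraic ends and `P, Q ∈ K[X]` (`K = ℚ̄ ∩ ℝ`), `Q`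
pole-free on `[a,b]`, and (c) point representations `[pt, r]` with `r` real algebraic, whose value
vanishes, is a Kontsevich–Zagier relation. E.g. every `ℤ`-relation `Σ nⱼ cⱼ log(bⱼ/aⱼ) + Σ m_l d_l
arctan t_l + r = 0` among values of carriers is realised by the four moves.
[cite: KontsevichZagier2001, §1.2 Conjecture 1] -/
theorem mem_relations_of_eval_eq_zero_of_algSlab {x : FormalRep}
    (hx : x ∈ AddSubgroup.closure
      ({y : FormalRep | ∃ (m : ℕ) (N : IntegralRep m), m ≤ 1 ∧ N.IsRational ∧ y = of N} ∪
       {y : FormalRep | ∃ (a b : ℝ) (P Q : (algebraicClosure ℚ ℝ)[X]) (N : IntegralRep 1),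
          IsAlgebraic ℚ a ∧ IsAlgebraic ℚ b ∧ (∀ t ∈ Set.Icc a b, (Polynomial.aeval t Q : ℝ) ≠ 0) ∧
          N.domain = {x | x 0 ∈ Set.Ioo a b} ∧
          EqOn N.integrand (fun x => (Polynomial.aeval (x 0) P : ℝ) / Polynomial.aeval (x 0) Q) N.domain ∧
          y = of N} ∪
       {y : FormalRep | ∃ (r : ℝ) (Z : IntegralRep 0), IsAlgebraic ℚ r ∧ Z.domain = univ ∧
          (Z.integrand = fun _ => r) ∧ y = of Z}))
    (hv : eval x = 0) : x ∈ relations := by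
  classical
  obtain ⟨RA, hR⟩ := exists_carrierA
  obtain ⟨ZA, hZ⟩ := exists_ptCarrierA
  obtain ⟨RG, hRG⟩ := exists_angCarrier
  obtain ⟨r, k, u, c, k', t, d, hr, hu1, hu, hc, ht0, ht, hd, hEq⟩ :=
    nfD_of_mem_closure_algSlab hR hZ hRG hx
  exact (QuotientAddGroup.eq_zero_iff _).mp
    (nfD_eq_zero_of_eval_eq_zero hR hZ hRG x hr hu1 hu hc ht0 ht hd hEq hv)

end Dlog

end Summit.KontsevichZagierPeriods.HurwitzMicroSectors.NormalFormPrinciple.PiBox
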